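/-
Copyright (c) 2026 the pub-hodgecm-mathlib formalisation cell (harness21).  Prover seat hodgecm-mathlib-A-p19 (g20), D-T road (Tamagawa ∕ (K7-s)),
brick B1 «D-T3′-def» (LEAD F0P3a-plan (g8) WORDS T7-79 ∕ T7-86, 2026-09-01).
-/
import Literature.NumberTheory.Automorphic.UnitaryGroupArchCayleyHaar
import Mathlib.MeasureTheory.Measure.Haar.OfBasis
import Mathlib.MeasureTheory.Measure.Lebesgue.EqHaar
import HarnessLib

/-!
# The top-form-normalised Haar measure of `U(J)(E ⊗ ℝ)`: the canonical trace-form Lebesgue measure on the Lie algebra `𝔲(J)`, transported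
# through the Cayley window (Rogawski 1990 §1.7 «`dg = |Ω|_v`»; Helgason 2000 Ch. I §1 Thm. 1.14; Macdonald 1980)

Topic `NumberTheory/Weil1964` (the D-T road's measure bricks: ★ D-T1a `GLnHaarOfAddHaar`, ★ `MatrixAddHaarModule`); namespace
`Literature.NumberTheory.Weil1964.UnitaryArchTopForm`.  DEFINITIONS WITH BODIES (`reTr`, `traceForm`, `lieGram`, `lieFinBasis`, `lieGramDet`, `lieStdLebesgue`,
`windowRadius`, `window`, `archTopFormHaar`) and proved theorems; no named fact (net debt 0), no instance, no notation, no `sorry`.  Cell `pub/hodgecm-mathlib`,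
crux H413 = `stmt-HodgeConjecture-24833`; D-T road row «D-T3′» (A-p19 (g20) censuses `CENSUS-DT3inf-ArchVolumeFactor` 3aedca195ae9d375 and
`CENSUS-DT3prime-def-ArchTopFormHaar` bc75f54c287f16e8, adopted LEAD T7-79 ∕ T7-86: design (α\*)).

THE DESIGN (the same sentence as ★ D-T1a's inline `GL_n` spelling `Measure.comap Units.val (dX.withDensity fun X => (‖det X‖⁻¹)ⁿ)`: Lie-algebra Lebesgue ⟶ chart ⟶
Jacobian weight).  (1) On `M = M_N(E ⊗ ℝ)` the real trace form `β(X, Y) = Tr^{E⊗ℝ}_ℝ-part(tr(XY))` (`reTr ∘ Matrix.trace`, `reTr` = sum of the real coordinates and of the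
real parts of the complex coordinates of `E ⊗ ℝ = ℝ^{r₁} × ℂ^{r₂}`) is a symmetric `ℝ`-bilinear form, invariant under `X ↦ x⁻¹ X x`; its Gram determinant on a real basis `B`
of the Lie algebra `𝔲(J) = archSkew F E c N J` transforms by `det(P)²` under a change of basis `P`, so **`lieStdLebesgue J := √|det β(B_i, B_j)| • B.addHaar`** is a Lebesgue
measure on `𝔲(J)` INDEPENDENT of `B` (`lieStdLebesgue_eq_smul_addHaar`) — at a complex place, for the real form `𝔲(J) ⊂ M_N(ℂ)`, `√|det β(B)| = |det_ℂ[B ∣ (E_ij)]|`, i.e.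
this IS `|ω_std|` for the standard complex top form `ω_std = ∧ dE_ij` restricted to the real form, hence the SAME number for every inner form `U(J′)`, `J′` of any signature
(print's «compatible measures `dg = |Ω|`, `dg′ = |Ω′|`, `Ω′ = ψ^*Ω`», [Rogawski1990 §1.7 p. 6]).  (2) ★ B5b `UnitaryGroupArchCayleyHaar` says every Haar measure of
`U(J)(E ⊗ ℝ)` restricted to a Cayley window `ĉ(V₀)` is `κ • ĉ_*(w₀ · λ|_{V₀})` for every Lebesgue `λ` on `𝔲`; **`archTopFormHaar J`** is the Haar measure with `κ = 1` for
`λ = lieStdLebesgue J` (`archTopFormHaar_restrict_window`): the left-invariant measure whose germ at `1` in the Cayley chart is `w₀ · |ω_std|`.  NORMALISATION NOTE (REF1 (g8)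
R-39 (a)): since `Dĉ(0) = −2·id` (★ `hasFDerivAt_cayley_zero`) and `w₀(0) = 1`, this is `2^{−d} · |Ω_J|` for the left-invariant top form `Ω_J` with `Ω_J(1) = ω_std|_{𝔲(J)}`,
`d = dim_ℝ 𝔲(J)` — a universal constant depending only on `(E, N)`, which CANCELS in every same-`(E, N)` comparison of inner forms ((K7-s)) and must be carried by any ABSOLUTE
volume letter (none exists, census D-T3∞).
NON-DEGENERACY of `β` on `𝔲(J)` (`lieGramDet ≠ 0`) is TAKEN AS A HYPOTHESIS `hnd` by the two theorems that need it (it holds for every non-degenerate `J` — `𝔲(J)` is a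
real form of `M_N` at each place —; its proof per place type is brick B1′, with the conjugation-transport `archTopFormHaar_map_conj` and `det(Ad x) = 1`).
HONEST SCOPE.  Measure-theoretic bookkeeping over ★ B5b and Mathlib (`Basis.addHaar`, `addHaar_parallelepiped`, the averaging lemma ★ `HaarLocalChartLeft`); no manifold,
no Lie theory, no evaluation of any volume.  HC_CM is proved only modulo the printed citations until rung 0 closes; this file discharges no printed statement — it NAMES the
measure the relative identity (K7-s) [Rogawski1990 §14.5 p. 239; Kottwitz1988 Prop. 2] speaks about at `∞` (D-T3′), nothing more.

* §1 `reTr`, `traceForm` (+ `traceForm_apply`), `lieGram` (+ `lieGram_apply`, `lieGram_basis_change`), `lieFinBasis`, `lieGramDet`, **`lieStdLebesgue`**,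
  `lieStdLebesgue_def`, **`lieStdLebesgue_eq_smul_addHaar`** (basis independence), `isAddHaarMeasure_lieStdLebesgue` (under `hnd`).
* §2 `windowRadius` (+ `_pos`, `closedBall_windowRadius_subset`), `window`, **`archTopFormHaar`**, `archTopFormHaar_def`, `cayleyChartMeasure_window_ne_zero ∕ _ne_top`,
  **`isHaarMeasure_archTopFormHaar`**, **`archTopFormHaar_restrict_window`** (`(archTopFormHaar J)|_{ĉ(V₀)} = ĉ_*(w₀ · lieStdLebesgue J|_{V₀})`).

## References
* J. D. Rogawski, *Automorphic Representations of Unitary Groups in Three Variables*, Ann. of Math. Stud. 123 (1990), §1.7 p. 6 (algebraic ∕ compatible ∕ local Tamagawa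
  measures `|Ω|_v`), p. 11. [Rogawski1990]
* S. Helgason, *Groups and Geometric Analysis*, AMS Math. Surveys Monogr. 83 (2000), Ch. I §1 Thm. 1.14 p. 96 (Haar measure in a chart). [Helgason2000]
* I. G. Macdonald, *The volume of a compact Lie group*, Invent. Math. 56 (1980), 93–95 (the trace-form normalisation). [Macdonald1980]
* A. W. Knapp, *Lie Groups Beyond an Introduction*, 2nd ed. (2002), VIII §2. [Knapp2002]
-/

set_option autoImplicit false
-- the scoped normed structure on the submodule `𝔲 ≤ M_N(E ⊗ ℝ)` is only reducibly defeq to the subtype uniformity ∕ topology carried by the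
-- `[BorelSpace ↥(archSkew …)]` binder (as in ★ `UnitaryGroupArchCayleyHaar`, ★ `ArchTestKcPackage`)
set_option backward.isDefEq.respectTransparency false

noncomputable section

open NumberField NumberField.mixedEmbedding Set Filter Topology MeasureTheory MeasureTheory.Measure
open Literature.NumberTheory.Automorphic Literature.NumberTheory.Automorphic.UnitaryGroup
open scoped Classical Matrix Matrix.Norms.Operator MatrixGroups ENNReal NNReal Pointwise

namespace Literature.NumberTheory.Weil1964

namespace UnitaryArchTopForm

/-! ## §1 The trace form on `M_N(E ⊗ ℝ)` and the canonical Lebesgue measure on `𝔲(J)` -/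

section TraceForm

variable (F E : Type) [Field F] [Field E] [NumberField E] [Algebra F E] (c : E ≃ₐ[F] E) (N : ℕ) (J : Matrix (Fin N) (Fin N) E)

/-- The real part of the trace `E ⊗ ℝ = ℝ^{r₁} × ℂ^{r₂} → ℝ`: sum of the real coordinates plus the real parts of the complex coordinates (at a complex place this reads
the complex trace form `tr(XY)` through `Re`, which on the real form `𝔲(J)` is the form itself). [cite: Rogawski1990, §1.7 p. 6] -/
def reTr : mixedSpace E →ₗ[ℝ] ℝ where
  toFun x := ∑ w, x.1 w + ∑ w, (x.2 w).re
  map_add' x y := by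
    simp only [Prod.fst_add, Prod.snd_add, Pi.add_apply, Complex.add_re, Finset.sum_add_distrib]
    ring
  map_smul' t x := by
    simp only [Prod.smul_fst, Prod.smul_snd, Pi.smul_apply, smul_eq_mul, Complex.real_smul, Complex.re_ofReal_mul, RingHom.id_apply,
      mul_add, Finset.mul_sum]

/-- **The trace form** `β(X, Y) = reTr (tr (X Y))` on `M_N(E ⊗ ℝ)`, as an `ℝ`-bilinear map. [cite: Macdonald1980, p. 93] [cite: Rogawski1990, §1.7 p. 6] -/
def traceForm : Matrix (Fin N) (Fin N) (mixedSpace E) →ₗ[ℝ] Matrix (Fin N) (Fin N) (mixedSpace E) →ₗ[ℝ] ℝ :=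
  LinearMap.mk₂ ℝ (fun X Y => reTr E (Matrix.trace (X * Y)))
    (fun X₁ X₂ Y => by simp only [add_mul, Matrix.trace_add, map_add])
    (fun t X Y => by simp only [smul_mul_assoc, Matrix.trace_smul, map_smul, smul_eq_mul])
    (fun X Y₁ Y₂ => by simp only [mul_add, Matrix.trace_add, map_add])
    (fun t X Y => by simp only [mul_smul_comm, Matrix.trace_smul, map_smul, smul_eq_mul])

/-- Unfolding `traceForm`. [cite: Macdonald1980, p. 93] -/
theorem traceForm_apply (X Y : Matrix (Fin N) (Fin N) (mixedSpace E)) : traceForm E N X Y = reTr E (Matrix.trace (X * Y)) := rfl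

variable {F E c N}

/-- The Gram matrix of the trace form on a family of elements of `𝔲(J)`. [cite: Macdonald1980, p. 93] -/
def lieGram {ι : Type} (B : ι → archSkew F E c N J) : Matrix ι ι ℝ :=
  Matrix.of fun i j => traceForm E N (B i : Matrix (Fin N) (Fin N) (mixedSpace E)) (B j : Matrix (Fin N) (Fin N) (mixedSpace E))

/-- Entries of the Gram matrix. [cite: Macdonald1980, p. 93] -/
theorem lieGram_apply {ι : Type} (B : ι → archSkew F E c N J) (i j : ι) :
    lieGram J B i j = traceForm E N (B i : Matrix (Fin N) (Fin N) (mixedSpace E)) (B j : Matrix (Fin N) (Fin N) (mixedSpace E)) := rfl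

/-- **Change of basis for the Gram matrix**: for a basis `B` of `𝔲(J)` and any family `v`, `Gram(v) = Pᵀ · Gram(B) · P` with `P = B.toMatrix v`
(`v j = ∑ i, P i j • B i`). [cite: Macdonald1980, p. 93] -/
theorem lieGram_basis_change {ι : Type} [Fintype ι] (B : Module.Basis ι ℝ (archSkew F E c N J)) (v : ι → archSkew F E c N J) :
    lieGram J v = (B.toMatrix v)ᵀ * lieGram J B * B.toMatrix v := by
  ext i j
  have hvi : (v i : Matrix (Fin N) (Fin N) (mixedSpace E)) = ∑ k, B.toMatrix v k i • (B k : Matrix (Fin N) (Fin N) (mixedSpace E)) := by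
    conv_lhs => rw [← B.sum_toMatrix_smul_self v i]
    rw [Submodule.coe_sum]; rfl
  have hvj : (v j : Matrix (Fin N) (Fin N) (mixedSpace E)) = ∑ l, B.toMatrix v l j • (B l : Matrix (Fin N) (Fin N) (mixedSpace E)) := by
    conv_lhs => rw [← B.sum_toMatrix_smul_self v j]
    rw [Submodule.coe_sum]; rfl
  rw [lieGram_apply, hvi, hvj, _root_.map_sum (traceForm E N _), Matrix.mul_apply]
  refine Finset.sum_congr rfl fun l _ => ?_
  rw [LinearMap.map_smul, _root_.map_sum (traceForm E N), LinearMap.sum_apply, Matrix.mul_apply, smul_eq_mul]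
  simp only [LinearMap.map_smul, LinearMap.smul_apply, smul_eq_mul, Matrix.transpose_apply, lieGram_apply]
  exact mul_comm _ _

variable (F E c N) in
/-- A basis of `𝔲(J)` indexed by `Fin (finrank)` (the one the definitions use; any other basis gives the same measure, `lieStdLebesgue_eq_smul_addHaar`).
[cite: Knapp2002, VIII §2] -/
def lieFinBasis : Module.Basis (Fin (Module.finrank ℝ (archSkew F E c N J))) ℝ (archSkew F E c N J) :=
  haveI : FiniteDimensional ℝ (Matrix (Fin N) (Fin N) (mixedSpace E)) := finiteDimensional_matrix
  Module.finBasis ℝ (archSkew F E c N J)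

variable (F E c N) in
/-- The Gram determinant of the trace form on `𝔲(J)` in the basis of record (non-zero iff `β|_{𝔲(J)}` is non-degenerate). [cite: Macdonald1980, p. 93] -/
def lieGramDet : ℝ := (lieGram J (lieFinBasis F E c N J)).det

variable [MeasurableSpace (archSkew F E c N J)] [BorelSpace (archSkew F E c N J)]

variable (F E c N) in
/-- **THE CANONICAL LEBESGUE MEASURE ON `𝔲(J)`**: `√|det β(B_i, B_j)| • B.addHaar` for the basis of record `B` — the measure `|ω_std|` of the real form `𝔲(J)` for the
standard top form of `M_N` (basis-independent: `lieStdLebesgue_eq_smul_addHaar`). [cite: Macdonald1980, p. 93] [cite: Rogawski1990, §1.7 p. 6] -/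
def lieStdLebesgue : Measure (archSkew F E c N J) :=
  ENNReal.ofReal (Real.sqrt |lieGramDet F E c N J|) • (lieFinBasis F E c N J).addHaar

/-- Unfolding `lieStdLebesgue`. [cite: Macdonald1980, p. 93] -/
theorem lieStdLebesgue_def :
    lieStdLebesgue F E c N J = ENNReal.ofReal (Real.sqrt |(lieGram J (lieFinBasis F E c N J)).det|) • (lieFinBasis F E c N J).addHaar := rfl

/-- Two bases with the same index type: `B′.addHaar = |B.det B′|⁻¹ • B.addHaar`. [cite: Knapp2002, VIII §2] -/
theorem addHaar_eq_smul_addHaar {ι : Type} [Fintype ι] (B B' : Module.Basis ι ℝ (archSkew F E c N J)) :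
    B'.addHaar = (ENNReal.ofReal |B.det B'|)⁻¹ • B.addHaar := by
  haveI : FiniteDimensional ℝ (Matrix (Fin N) (Fin N) (mixedSpace E)) := finiteDimensional_matrix
  have hdet : B.det B' ≠ 0 := (B.isUnit_det B').ne_zero
  have h0 : ENNReal.ofReal |B.det B'| ≠ 0 := by
    rw [Ne, ENNReal.ofReal_eq_zero, not_le]; exact abs_pos.2 hdet
  haveI : IsAddHaarMeasure ((ENNReal.ofReal |B.det B'|)⁻¹ • B.addHaar) :=
    IsAddHaarMeasure.smul _ (ENNReal.inv_ne_zero.2 ENNReal.ofReal_ne_top) (ENNReal.inv_ne_top.2 h0)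
  rw [Module.Basis.addHaar_eq_iff]
  rw [Measure.smul_apply, smul_eq_mul, Module.Basis.coe_parallelepiped, addHaar_parallelepiped, ENNReal.inv_mul_cancel h0 ENNReal.ofReal_ne_top]

/-- **BASIS INDEPENDENCE**: for EVERY finite basis `B` of `𝔲(J)`, `lieStdLebesgue J = √|det β(B_i, B_j)| • B.addHaar`.  (Change of basis `P`: the Gram determinant
acquires `det(P)²`, `B.addHaar` acquires `|det P|⁻¹`.) [cite: Macdonald1980, p. 93] [cite: Knapp2002, VIII §2] -/
theorem lieStdLebesgue_eq_smul_addHaar {ι : Type} [Fintype ι] (B : Module.Basis ι ℝ (archSkew F E c N J)) :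
    lieStdLebesgue F E c N J = ENNReal.ofReal (Real.sqrt |(lieGram J B).det|) • B.addHaar := by
  haveI : FiniteDimensional ℝ (Matrix (Fin N) (Fin N) (mixedSpace E)) := finiteDimensional_matrix
  -- reindex the basis of record to `ι`
  set B₀ := lieFinBasis F E c N J with hB₀
  let e : Fin (Module.finrank ℝ (archSkew F E c N J)) ≃ ι := B₀.indexEquiv B
  set B₁ : Module.Basis ι ℝ (archSkew F E c N J) := B₀.reindex e with hB₁
  have hH : B₁.addHaar = B₀.addHaar := B₀.addHaar_reindex e
  have hG : (lieGram J B₁).det = (lieGram J B₀).det := by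
    have : lieGram J B₁ = Matrix.reindex e e (lieGram J B₀) := by
      ext i j; simp only [lieGram_apply, hB₁, Module.Basis.reindex_apply, Matrix.reindex_apply, Matrix.submatrix_apply]
    rw [this, Matrix.det_reindex_self]
  rw [lieStdLebesgue_def, ← hB₀, ← hH, ← hG]
  -- change of basis `B₁ ↦ B`
  set P := B₁.toMatrix B with hP
  have hGB : (lieGram J B).det = P.det ^ 2 * (lieGram J B₁).det := by
    rw [lieGram_basis_change J B₁ B, Matrix.det_mul, Matrix.det_mul, Matrix.det_transpose]; ring
  have hdet : B₁.det B = P.det := B₁.det_apply B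
  have hP0 : P.det ≠ 0 := by rw [← hdet]; exact (B₁.isUnit_det B).ne_zero
  rw [addHaar_eq_smul_addHaar J B₁ B, hdet, hGB, smul_smul]
  congr 1
  have h0 : ENNReal.ofReal |P.det| ≠ 0 := by
    rw [Ne, ENNReal.ofReal_eq_zero, not_le]; exact abs_pos.2 hP0
  rw [abs_mul, abs_pow, Real.sqrt_mul (pow_nonneg (abs_nonneg _) 2), Real.sqrt_sq (abs_nonneg _), ENNReal.ofReal_mul (abs_nonneg _),
    mul_right_comm, ENNReal.mul_inv_cancel h0 ENNReal.ofReal_ne_top, one_mul]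

/-- Under non-degeneracy of the trace form on `𝔲(J)`, `lieStdLebesgue J` is an additive Haar (Lebesgue) measure. [cite: Macdonald1980, p. 93] -/
theorem isAddHaarMeasure_lieStdLebesgue (hnd : lieGramDet F E c N J ≠ 0) : (lieStdLebesgue F E c N J).IsAddHaarMeasure := by
  rw [lieStdLebesgue_def]
  refine IsAddHaarMeasure.smul _ ?_ ENNReal.ofReal_ne_top
  rw [Ne, ENNReal.ofReal_eq_zero, not_le]
  exact Real.sqrt_pos.2 (abs_pos.2 hnd)

end TraceForm

/-! ## §2 The top-form-normalised Haar measure of `U(J)(E ⊗ ℝ)` through the Cayley window -/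

section Haar

variable (F E : Type) [Field F] [Field E] [NumberField E] [Algebra F E] (c : E ≃ₐ[F] E) (N : ℕ) (J : Matrix (Fin N) (Fin N) E)

variable {F E c N}

variable (F E c N) in
/-- The radius of the Cayley window of record: a closed ball of `𝔲(J)` around `0` of this radius lies in the chart source (★ `exists_closedBall_subset_cayleySource`).
[cite: Helgason2000, Ch. I §1 Thm. 1.14 p. 96] -/
def windowRadius : ℝ := Classical.choose (exists_closedBall_subset_cayleySource (F := F) (c := c) J)

/-- The window radius is positive. [cite: Helgason2000, Ch. I §1 Thm. 1.14 p. 96] -/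
theorem windowRadius_pos : 0 < windowRadius F E c N J := (Classical.choose_spec (exists_closedBall_subset_cayleySource (F := F) (c := c) J)).1

/-- The closed ball of the window radius lies in the chart source. [cite: Helgason2000, Ch. I §1 Thm. 1.14 p. 96] -/
theorem closedBall_windowRadius_subset : Metric.closedBall (0 : archSkew F E c N J) (windowRadius F E c N J) ⊆ cayleySource F E c N J :=
  (Classical.choose_spec (exists_closedBall_subset_cayleySource (F := F) (c := c) J)).2

variable (F E c N) in
/-- The Cayley window of record in `𝔲(J)`: the open ball of radius `windowRadius`. [cite: Helgason2000, Ch. I §1 Thm. 1.14 p. 96] -/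
def window : Set (archSkew F E c N J) := Metric.ball 0 (windowRadius F E c N J)

/-- The window is open. [cite: Helgason2000, Ch. I §1 Thm. 1.14 p. 96] -/
theorem isOpen_window : IsOpen (window F E c N J) := Metric.isOpen_ball

/-- `0` lies in the window. [cite: Helgason2000, Ch. I §1 Thm. 1.14 p. 96] -/
theorem zero_mem_window : (0 : archSkew F E c N J) ∈ window F E c N J := Metric.mem_ball_self (windowRadius_pos J)

/-- The window lies in the chart source. [cite: Helgason2000, Ch. I §1 Thm. 1.14 p. 96] -/
theorem window_subset_cayleySource : window F E c N J ⊆ cayleySource F E c N J :=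
  Metric.ball_subset_closedBall.trans (closedBall_windowRadius_subset J)

/-- The chart image of the window is open in `U(J)(E ⊗ ℝ)`. [cite: Helgason2000, Ch. I §1 Thm. 1.14 p. 96] -/
theorem isOpen_image_window : IsOpen (cayleyChart F E c N J '' window F E c N J) :=
  isOpen_image_cayleyChart J (window_subset_cayleySource J) (isOpen_window J)

/-- The chart image of the window is non-empty (`ĉ 0 = 1` lies in it). [cite: Helgason2000, Ch. I §1 Thm. 1.14 p. 96] -/
theorem image_window_nonempty : (cayleyChart F E c N J '' window F E c N J).Nonempty := ⟨_, ⟨0, zero_mem_window J, rfl⟩⟩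

/-- The chart image of the window is relatively compact (inside the image of the closed ball). [cite: Helgason2000, Ch. I §1 Thm. 1.14 p. 96] -/
theorem isCompact_closure_image_window : IsCompact (closure (cayleyChart F E c N J '' window F E c N J)) := by
  haveI : FiniteDimensional ℝ (Matrix (Fin N) (Fin N) (mixedSpace E)) := finiteDimensional_matrix
  have hK : IsCompact (cayleyChart F E c N J '' Metric.closedBall 0 (windowRadius F E c N J)) :=
    (isCompact_closedBall (0 : archSkew F E c N J) _).image_of_continuousOn ((continuousOn_cayleyChart J).mono (closedBall_windowRadius_subset J))
  exact hK.closure_of_subset (Set.image_mono Metric.ball_subset_closedBall)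

variable [MeasurableSpace (archSkew F E c N J)] [BorelSpace (archSkew F E c N J)] [MeasurableSpace (arch F E c N J)] [BorelSpace (arch F E c N J)]

variable (F E c N) in
/-- **THE TOP-FORM-NORMALISED HAAR MEASURE OF `U(J)(E ⊗ ℝ)`**: the Haar measure whose restriction to the Cayley window `ĉ(V₀)` is EXACTLY the chart measure
`ĉ_*(w₀ · lieStdLebesgue J|_{V₀})` (`archTopFormHaar_restrict_window`) — i.e. `2^{−d} · |Ω_J|` for the left-invariant top form `Ω_J` with `Ω_J(1) = ω_std|_{𝔲(J)}`,
`d = dim_ℝ 𝔲(J)` (the Cayley chart has `Dĉ(0) = −2·id`; REF1 R-39 (a)).  Defined as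
`(ν(W) ∕ μ₀(W)) • μ₀` for Mathlib's Haar measure of record `μ₀ = Measure.haar`, `W = ĉ(V₀)`, `ν` the chart measure (★ B5b: `ν = κ • μ₀|_W`, so this is `κ • μ₀`).
[cite: Rogawski1990, §1.7 p. 6] [cite: Helgason2000, Ch. I §1 Thm. 1.14 p. 96] [cite: Macdonald1980, p. 93] -/
def archTopFormHaar : Measure (arch F E c N J) :=
  (cayleyChartMeasure F E c N J (lieStdLebesgue F E c N J) (window F E c N J) (cayleyChart F E c N J '' window F E c N J) /
      Measure.haar (cayleyChart F E c N J '' window F E c N J)) • Measure.haar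

/-- Unfolding `archTopFormHaar`. [cite: Helgason2000, Ch. I §1 Thm. 1.14 p. 96] -/
theorem archTopFormHaar_def :
    archTopFormHaar F E c N J =
      (cayleyChartMeasure F E c N J (lieStdLebesgue F E c N J) (window F E c N J) (cayleyChart F E c N J '' window F E c N J) /
          Measure.haar (cayleyChart F E c N J '' window F E c N J)) • Measure.haar := rfl

omit [MeasurableSpace (archSkew F E c N J)] [BorelSpace (archSkew F E c N J)] [BorelSpace (arch F E c N J)] in
/-- `0 < μ(ĉ(V₀))` for every Haar measure `μ` (the window is open and non-empty). [cite: Helgason2000, Ch. I §1 Thm. 1.14 p. 96] -/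
theorem haar_image_window_ne_zero (μ : Measure (arch F E c N J)) [μ.IsHaarMeasure] : μ (cayleyChart F E c N J '' window F E c N J) ≠ 0 :=
  ((isOpen_image_window J).measure_pos μ (image_window_nonempty J)).ne'

omit [MeasurableSpace (archSkew F E c N J)] [BorelSpace (archSkew F E c N J)] [BorelSpace (arch F E c N J)] in
/-- `μ(ĉ(V₀)) < ∞` for every Haar measure `μ` (the window is relatively compact). [cite: Helgason2000, Ch. I §1 Thm. 1.14 p. 96] -/
theorem haar_image_window_ne_top (μ : Measure (arch F E c N J)) [μ.IsHaarMeasure] : μ (cayleyChart F E c N J '' window F E c N J) ≠ ⊤ :=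
  ((measure_mono subset_closure).trans_lt (isCompact_closure_image_window J).measure_lt_top).ne

/-- The chart measure of the window is `∫_{V₀} w₀ dλ`. [cite: Helgason2000, Ch. I §1 Thm. 1.14 p. 96] -/
theorem cayleyChartMeasure_image_window (lam : Measure (archSkew F E c N J)) :
    cayleyChartMeasure F E c N J lam (window F E c N J) (cayleyChart F E c N J '' window F E c N J) =
      ∫⁻ X in window F E c N J, ENNReal.ofReal (cayleyWeight F E c N J X) ∂lam := by
  have hVW : cayleyChart F E c N J ⁻¹' (cayleyChart F E c N J '' window F E c N J) ∩ window F E c N J = window F E c N J :=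
    Set.inter_eq_right.2 fun X hX => ⟨X, hX, rfl⟩
  rw [cayleyChartMeasure_apply J lam _ (isOpen_image_window J).measurableSet, hVW]

/-- `ν(W) ≠ 0` for an additive Haar `λ`: the weight is positive on the window. [cite: Helgason2000, Ch. I §1 Thm. 1.14 p. 96] -/
theorem cayleyChartMeasure_image_window_ne_zero (lam : Measure (archSkew F E c N J)) [lam.IsAddHaarMeasure] :
    cayleyChartMeasure F E c N J lam (window F E c N J) (cayleyChart F E c N J '' window F E c N J) ≠ 0 := by
  rw [cayleyChartMeasure_image_window J lam]
  refine ne_of_gt ?_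
  rw [lintegral_pos_iff_support (measurable_cayleyWeight J).ennreal_ofReal, Measure.restrict_apply' (isOpen_window J).measurableSet]
  have hsub : window F E c N J ⊆ (Function.support fun X => ENNReal.ofReal (cayleyWeight F E c N J X)) ∩ window F E c N J :=
    fun X hX => ⟨(ENNReal.ofReal_pos.2 (cayleyWeight_pos J (window_subset_cayleySource J hX))).ne', hX⟩
  exact ((isOpen_window J).measure_pos lam ⟨0, zero_mem_window J⟩).trans_le (measure_mono hsub)

/-- `ν(W) ≠ ∞` for a measure `λ` finite on compacta: the weight is bounded on the closed ball. [cite: Helgason2000, Ch. I §1 Thm. 1.14 p. 96] -/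
theorem cayleyChartMeasure_image_window_ne_top (lam : Measure (archSkew F E c N J)) [IsFiniteMeasureOnCompacts lam] :
    cayleyChartMeasure F E c N J lam (window F E c N J) (cayleyChart F E c N J '' window F E c N J) ≠ ⊤ := by
  haveI : FiniteDimensional ℝ (Matrix (Fin N) (Fin N) (mixedSpace E)) := finiteDimensional_matrix
  obtain ⟨X₀, -, hmax⟩ := (isCompact_closedBall (0 : archSkew F E c N J) (windowRadius F E c N J)).exists_isMaxOn
    ⟨0, Metric.mem_closedBall_self (windowRadius_pos J).le⟩ ((continuousOn_cayleyWeight J).mono (closedBall_windowRadius_subset J))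
  rw [cayleyChartMeasure_image_window J lam]
  refine ne_of_lt ?_
  calc ∫⁻ X in window F E c N J, ENNReal.ofReal (cayleyWeight F E c N J X) ∂lam
      ≤ ∫⁻ X in window F E c N J, ENNReal.ofReal (cayleyWeight F E c N J X₀) ∂lam :=
        setLIntegral_mono measurable_const fun X hX => ENNReal.ofReal_le_ofReal (hmax (Metric.ball_subset_closedBall hX))
    _ = ENNReal.ofReal (cayleyWeight F E c N J X₀) * lam (window F E c N J) := setLIntegral_const _ _
    _ < ⊤ := ENNReal.mul_lt_top ENNReal.ofReal_lt_top
        ((measure_mono Metric.ball_subset_closedBall).trans_lt (isCompact_closedBall (0 : archSkew F E c N J) _).measure_lt_top)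

/-- **`archTopFormHaar J` IS A HAAR MEASURE** (under non-degeneracy of the trace form on `𝔲(J)`): a positive finite multiple of `Measure.haar`.
[cite: Helgason2000, Ch. I §1 Thm. 1.14 p. 96] [cite: Rogawski1990, §1.7 p. 6] -/
theorem isHaarMeasure_archTopFormHaar (hnd : lieGramDet F E c N J ≠ 0) : (archTopFormHaar F E c N J).IsHaarMeasure := by
  haveI := isAddHaarMeasure_lieStdLebesgue J hnd
  rw [archTopFormHaar_def]
  refine IsHaarMeasure.smul (μ := (Measure.haar : Measure (arch F E c N J))) ?_ ?_
  · exact (ENNReal.div_pos_iff.2 ⟨cayleyChartMeasure_image_window_ne_zero J _,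
      haar_image_window_ne_top J (Measure.haar : Measure (arch F E c N J))⟩).ne'
  · exact ENNReal.div_ne_top (cayleyChartMeasure_image_window_ne_top J _) (haar_image_window_ne_zero J (Measure.haar : Measure (arch F E c N J)))

/-- **THE WINDOW IDENTITY**: `(archTopFormHaar J)|_{ĉ(V₀)} = ĉ_*(w₀ · lieStdLebesgue J|_{V₀})` — the defining normalisation («`κ = 1`»): on the Cayley window the measure IS
the chart image of the canonical Lebesgue measure with the Jacobian weight, i.e. `|Ω_J|` (★ B5b's local left-invariance + the averaging lemma ★ `HaarLocalChartLeft`).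
[cite: Helgason2000, Ch. I §1 Thm. 1.14 (13) p. 96] [cite: Rogawski1990, §1.7 p. 6] [cite: Knapp2002, VIII §2] -/
theorem archTopFormHaar_restrict_window (hnd : lieGramDet F E c N J ≠ 0) :
    (archTopFormHaar F E c N J).restrict (cayleyChart F E c N J '' window F E c N J) =
      cayleyChartMeasure F E c N J (lieStdLebesgue F E c N J) (window F E c N J) := by
  haveI := isAddHaarMeasure_lieStdLebesgue J hnd
  haveI : SFinite (lieStdLebesgue F E c N J) := by rw [lieStdLebesgue_def]; infer_instance
  set W := cayleyChart F E c N J '' window F E c N J with hW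
  set ν := cayleyChartMeasure F E c N J (lieStdLebesgue F E c N J) (window F E c N J) with hν
  haveI : SFinite ν := by rw [hν, cayleyChartMeasure]; infer_instance
  have hνW : ν Wᶜ = 0 := cayleyChartMeasure_compl_image J _ (window_subset_cayleySource J) (isOpen_window J)
  have hloc : ∀ (g : arch F E c N J) (B : Set (arch F E c N J)), MeasurableSet B → B ⊆ W → (fun x => g * x) ⁻¹' B ⊆ W →
      ν ((fun x => g * x) ⁻¹' B) = ν B :=
    fun g B hB hBW hgB => cayleyChartMeasure_preimage_mul J _ (isOpen_window J).measurableSet (window_subset_cayleySource J) g hB hBW hgB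
  -- the averaging lemma: `ν = κ • μ₀|_W`
  obtain ⟨κ, hκ⟩ : ∃ κ : ℝ≥0∞, ν = κ • (Measure.haar : Measure (arch F E c N J)).restrict W :=
    ⟨_, Literature.MeasureTheory.Group.HaarLocalChartLeft.eq_smul_restrict_of_locallyInvariant_of_isOpen (μ := Measure.haar) (ν := ν)
      (isOpen_image_window J) (image_window_nonempty J) (isCompact_closure_image_window J) hνW hloc⟩
  -- `κ = ν W ∕ μ₀ W`
  have hκW : ν W = κ * Measure.haar W := by
    have := congrArg (fun m : Measure (arch F E c N J) => m W) hκ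
    simpa only [Measure.smul_apply, smul_eq_mul, Measure.restrict_apply_self] using this
  have hκeq : ν W / Measure.haar W = κ := by
    symm
    rw [ENNReal.eq_div_iff (haar_image_window_ne_zero J (Measure.haar : Measure (arch F E c N J)))
      (haar_image_window_ne_top J (Measure.haar : Measure (arch F E c N J))), mul_comm, ← hκW]
  rw [archTopFormHaar_def, Measure.restrict_smul, ← hW, ← hν, hκeq, ← hκ]

end Haar

end UnitaryArchTopForm

end Literature.NumberTheory.Weil1964

end
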